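import Summits.ABC.ABC.Theorems.TwistAmplificationSharpModerateLawCoreTransfer
import Summits.ABC.ABC.Theorems.TwistAmplificationSharpModerateLawTwistedFreyFacts
import Summits.ABC.ABC.Theorems.TwistAmplificationSharpModerateLawCornerHallToHallRegime

/-!
# Crux `TwistAmplification.SharpModerateLaw` (stmt-ABC-1975): the pointwise child in cusp form is at least the summit

Crux-strategist `planner-cstrat-stmt-ABC-1975-p1-0`, 2026-08-17.  Calibration of the twist-orbit inversion split
(`Cruxes/SharpModerateLaw/TwistMinimalSplit.lean`): **`abc_of_pointwiseSzpiroCusp : PointwiseSzpiroCusp → ABC`**, through the Frey pair of an abc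
triple (`twistedFreyPair_facts` at `d = 1`: tower-free, `1728 ∣ c₄³ − c₆²`, `N* ≤ 2·rad(abc)`, `c₄³ ≥ 1728·c⁶`) and `n5cusp_le_nstar`.  With the landed
`generalizedSzpiroBG_iff_abc` and the provable support `CuspRealisation : GeneralizedSzpiroConjectureBG → PointwiseSzpiroCusp` this closes the circle
`PointwiseSzpiroCusp ⟺ GeneralizedSzpiroConjectureBG ⟺ ABC`: both hypotheses named "pointwise" in the split are exactly the summit.
-/

noncomputable section

set_option linter.dupNamespace false

namespace Summit.ABC.ABC.Theorems.SharpModerateLaw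

open Literature.NumberTheory.DiophantineGeometry (rad IsABCTriple)
open CuspDispersion (Nstar twistedFreyPair_facts)
open UnitPlane (n5cusp_le_nstar)

/-! Self-contained restatement (verbatim, hence definitionally equal) of the two split decls this calibration is about; the originals live in
the crux workfile `Cruxes/SharpModerateLaw/TwistMinimalSplit.lean`, which Theorems files do not import. -/
namespace Calibration

/-- = `SharpModerateLaw.PointwiseSzpiroCusp` of `TwistMinimalSplit.lean` (verbatim). -/
def PointwiseSzpiroCusp : Prop :=
  ∀ η : ℝ, 0 < η → ∃ C : ℝ, ∀ x : ℤ × ℤ, x.1 ≠ 0 → x.2 ≠ 0 → x.1 ^ 3 ≠ x.2 ^ 2 → (1728 : ℤ) ∣ x.1 ^ 3 - x.2 ^ 2 →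
    TF x → (Mcusp x : ℝ) ≤ C * (N5cusp x : ℝ) ^ (6 + η)

/-- = `SharpModerateLaw.CuspRealisation` of `TwistMinimalSplit.lean` (verbatim). -/
def CuspRealisation : Prop :=
  Literature.NumberTheory.EllipticCurves.GeneralizedSzpiroConjectureBG → PointwiseSzpiroCusp

/-- Sixth-root extraction: `c⁶ ≤ K·r^{6(1+ε)}` with `K, r ≥ 0`, `c ≥ 0` gives `c ≤ K^{1/6}·r^{1+ε}`. -/
theorem le_of_pow_six_le {c r K ε : ℝ} (hc : 0 ≤ c) (hr : 0 ≤ r) (hK : 0 ≤ K)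
    (h : c ^ (6 : ℕ) ≤ K * r ^ (6 * (1 + ε))) : c ≤ K ^ (1 / 6 : ℝ) * r ^ (1 + ε) := by
  have h6 : (0 : ℝ) ≤ 1 / 6 := by norm_num
  have hl : (c ^ (6 : ℕ)) ^ (1 / 6 : ℝ) = c := by
    rw [← Real.rpow_natCast c 6, ← Real.rpow_mul hc]; norm_num
  have hrr : (r ^ (6 * (1 + ε))) ^ (1 / 6 : ℝ) = r ^ (1 + ε) := by
    rw [← Real.rpow_mul hr]; congr 1; ring
  calc c = (c ^ (6 : ℕ)) ^ (1 / 6 : ℝ) := hl.symm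
    _ ≤ (K * r ^ (6 * (1 + ε))) ^ (1 / 6 : ℝ) := Real.rpow_le_rpow (by positivity) h h6
    _ = K ^ (1 / 6 : ℝ) * r ^ (1 + ε) := by
        rw [Real.mul_rpow hK (Real.rpow_nonneg hr _), hrr]

/-- **`PointwiseSzpiroCusp → ABC`.**  Given `ε > 0` use the pointwise hypothesis at `η := 6ε` on the Frey pair `x = (c₄, c₆)` of an abc triple
`a + b = c` (`a ≠ b`; the triple `(1,1,2)` is handled by the constant): `1728·c⁶ ≤ c₄³ ≤ M⁺(x) ≤ C·N5cusp(x)^{6+6ε} ≤ C·(2·rad(abc))^{6+6ε}`, and take sixth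
roots. [folklore] -/
theorem abc_of_pointwiseSzpiroCusp (h : PointwiseSzpiroCusp) : _root_.ABC := by
  rw [ABC_iff]
  intro ε hε
  obtain ⟨C, hC⟩ := h (6 * ε) (by positivity)
  set C₀ : ℝ := max C 1 with hC₀
  have hC₀1 : 1 ≤ C₀ := le_max_right _ _
  have hC₀0 : 0 ≤ C₀ := by linarith
  -- the constant
  set K : ℝ := C₀ * (2 : ℝ) ^ (6 * (1 + ε)) / 1728 with hK
  have hK0 : 0 ≤ K := by rw [hK]; positivity
  have hK6 : 0 ≤ K ^ (1 / 6 : ℝ) := Real.rpow_nonneg hK0 _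
  refine ⟨K ^ (1 / 6 : ℝ) + 3, by linarith, ?_⟩
  intro a b c ht
  obtain ⟨ha, hb, habc, hcop⟩ := ht
  have hrad1 : (1 : ℝ) ≤ (rad a b c : ℝ) := by
    have : rad a b c ≠ 0 := by
      rw [Literature.NumberTheory.DiophantineGeometry.rad_def]; exact UniqueFactorizationMonoid.radical_ne_zero
    exact_mod_cast Nat.one_le_iff_ne_zero.mpr this
  have hrpow1 : (1 : ℝ) ≤ (rad a b c : ℝ) ^ (1 + ε) := Real.one_le_rpow hrad1 (by linarith)
  by_cases hab : a = b
  · -- `a = b` coprime forces `a = b = 1`, `c = 2`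
    subst hab
    have ha1 : a = 1 := by simpa [Nat.coprime_self] using hcop
    subst ha1
    have hc2 : c = 2 := by omega
    subst hc2
    have : (2 : ℝ) < (K ^ (1 / 6 : ℝ) + 3) * 1 := by linarith
    calc ((2 : ℕ) : ℝ) = 2 := by norm_num
      _ < (K ^ (1 / 6 : ℝ) + 3) * 1 := this
      _ ≤ (K ^ (1 / 6 : ℝ) + 3) * ((rad 1 1 2 : ℕ) : ℝ) ^ (1 + ε) :=
          mul_le_mul_of_nonneg_left hrpow1 (by positivity)
  · -- the Frey pair at `d = 1`
    set x : ℤ × ℤ := (((1 : ℕ) : ℤ) ^ 2 * (freyPair a b).1, ((1 : ℕ) : ℤ) ^ 3 * (freyPair a b).2) with hx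
    obtain ⟨h1, h2, h3, h4, hTF, hN, -, -, hpos, hcube, hlow, -⟩ :=
      twistedFreyPair_facts a b 1 ha hb hab hcop (Or.inl rfl) (Nat.coprime_one_left _) x hx
    have key := hC x h1 h2 h3 h4 hTF
    -- lower bound `1728 c⁶ ≤ M⁺(x)`
    have hM : (1728 : ℝ) * (c : ℝ) ^ (6 : ℕ) ≤ (Mcusp x : ℝ) := by
      have hM1 : x.1.natAbs ^ 3 ≤ Mcusp x := le_max_right _ _
      have hM2 : ((x.1.natAbs ^ 3 : ℕ) : ℤ) = x.1 ^ 3 := by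
        push_cast; simp [abs_of_nonneg hpos.le, Int.natAbs_of_nonneg hpos.le]
      have hM3 : (1728 : ℤ) * (c : ℤ) ^ 6 ≤ x.1 ^ 3 := by
        rw [hcube, ← habc]; push_cast; simp only [one_pow, mul_one]; linarith [hlow]
      have hM4 : (1728 : ℤ) * (c : ℤ) ^ 6 ≤ ((Mcusp x : ℕ) : ℤ) := by
        calc (1728 : ℤ) * (c : ℤ) ^ 6 ≤ x.1 ^ 3 := hM3
          _ = ((x.1.natAbs ^ 3 : ℕ) : ℤ) := hM2.symm
          _ ≤ ((Mcusp x : ℕ) : ℤ) := by exact_mod_cast hM1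
      exact_mod_cast hM4
    -- upper bound `N5cusp(x) ≤ 2 rad`
    have hN5 : (N5cusp x : ℝ) ≤ 2 * (rad a b c : ℝ) := by
      have : N5cusp x ≤ 2 * rad a b (a + b) * 1 ^ 2 := (n5cusp_le_nstar x).trans hN
      rw [habc] at this
      exact_mod_cast (by simpa using this)
    have hN50 : (0 : ℝ) ≤ (N5cusp x : ℝ) := Nat.cast_nonneg _
    have hexp : (0 : ℝ) ≤ 6 + 6 * ε := by linarith
    have hup : (Mcusp x : ℝ) ≤ C₀ * (2 * (rad a b c : ℝ)) ^ (6 + 6 * ε) := by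
      calc (Mcusp x : ℝ) ≤ C * (N5cusp x : ℝ) ^ (6 + 6 * ε) := key
        _ ≤ C₀ * (N5cusp x : ℝ) ^ (6 + 6 * ε) :=
            mul_le_mul_of_nonneg_right (le_max_left _ _) (Real.rpow_nonneg hN50 _)
        _ ≤ C₀ * (2 * (rad a b c : ℝ)) ^ (6 + 6 * ε) :=
            mul_le_mul_of_nonneg_left (Real.rpow_le_rpow hN50 hN5 hexp) hC₀0
    -- combine: `c⁶ ≤ K · rad^{6(1+ε)}`
    have hr0 : (0 : ℝ) ≤ (rad a b c : ℝ) := by linarith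
    have hsplit : (2 * (rad a b c : ℝ)) ^ (6 + 6 * ε) = (2 : ℝ) ^ (6 * (1 + ε)) * (rad a b c : ℝ) ^ (6 * (1 + ε)) := by
      rw [Real.mul_rpow (by norm_num) hr0]; congr 1 <;> ring_nf
    have hc6 : (c : ℝ) ^ (6 : ℕ) ≤ K * (rad a b c : ℝ) ^ (6 * (1 + ε)) := by
      have := hM.trans hup
      rw [hsplit] at this
      rw [hK]
      have h1728 : (0 : ℝ) < 1728 := by norm_num
      calc (c : ℝ) ^ (6 : ℕ) = (1728 * (c : ℝ) ^ (6 : ℕ)) / 1728 := by field_simp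
        _ ≤ (C₀ * ((2 : ℝ) ^ (6 * (1 + ε)) * (rad a b c : ℝ) ^ (6 * (1 + ε)))) / 1728 :=
            div_le_div_of_nonneg_right this h1728.le
        _ = C₀ * (2 : ℝ) ^ (6 * (1 + ε)) / 1728 * (rad a b c : ℝ) ^ (6 * (1 + ε)) := by ring
    have hcle : (c : ℝ) ≤ K ^ (1 / 6 : ℝ) * (rad a b c : ℝ) ^ (1 + ε) :=
      le_of_pow_six_le (Nat.cast_nonneg _) hr0 hK0 hc6
    calc (c : ℝ) ≤ K ^ (1 / 6 : ℝ) * (rad a b c : ℝ) ^ (1 + ε) := hcle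
      _ < (K ^ (1 / 6 : ℝ) + 3) * (rad a b c : ℝ) ^ (1 + ε) := by
          have : (0 : ℝ) < (rad a b c : ℝ) ^ (1 + ε) := by linarith
          nlinarith

/-- The circle closes: the cusp-form pointwise child and the catalogued conjecture are both the summit
(`CuspRealisation` is the provable support `GeneralizedSzpiroConjectureBG → PointwiseSzpiroCusp`). -/
theorem pointwiseSzpiroCusp_iff_abc (hreal : CuspRealisation) : PointwiseSzpiroCusp ↔ _root_.ABC :=
  ⟨abc_of_pointwiseSzpiroCusp, fun h => hreal (ModerateWindowCount.generalizedSzpiroBG_of_abc h)⟩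

end Calibration

end Summit.ABC.ABC.Theorems.SharpModerateLaw

end
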